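import Summits.Ventures.PercRepro.MSTightLemma
import Summits.Ventures.PercRepro.MSTightLeverR

/-!
# Members of a tight family against its partner family (unconditional)

For a tight `F` and an element `r`, with `F₀ = part0 r F` (members avoiding `r`),
`L = partr r F` (members containing `r`, with `r` removed) and `K = partner r F = F₀ ∩ L`
(the members whose `r`-twin is also a member), the equality structure `X ∩ Y = K \\ K`
(`tight_proj_and_partner`, via `mem_diffs_partner_of_both`) gives:

* (C1) `E \ b ∈ K \\ K` for every `E ∈ K` and `b ∈ F₀`, since `E \ b` and `(E ∪ r) \ b` are both
  differences (`sdiff_mem_diffs_partner_of_mem_part0`);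
* (C2) `a \ E ∈ K \\ K` for every `a ∈ L` and `E ∈ K`, since `(a ∪ r) \ (E ∪ r)` and `(a ∪ r) \ E`
  are both differences (`sdiff_mem_diffs_partner_of_mem_partr`);

and, by Lemma 3 and its dual (`MSTightLemma`, `K` tight and nonempty):

* every member avoiding `r` CONTAINS a member of `K` (`exists_partner_subset_of_mem_part0`);
* every member containing `r`, with `r` removed, LIES IN a member of `K`
  (`exists_subset_partner_of_mem_partr`).

These are the unconditional ingredients of Lemma B of proofs/MINE1-singlemerge.md §17.3
(the dichotomy without the down-closed hypothesis); what remains there is the convexity of `K`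
in its twin-class lattice (the inductive step of Theorem S).
-/

namespace PercRepro.MSTight

open Finset
open scoped FinsetFamily

variable {α : Type*} [DecidableEq α]

/-- **(C1).** `E \ b ∈ K \\ K` for `E ∈ partner r F`, `b ∈ part0 r F`. -/
theorem sdiff_mem_diffs_partner_of_mem_part0 {F : Finset (Finset α)} (hF : Tight F) {r : α}
    {E b : Finset α} (hE : E ∈ partner r F) (hb : b ∈ part0 r F) :
    E \ b ∈ partner r F \\ partner r F := by
  obtain ⟨hE0, hE1⟩ := Finset.mem_inter.1 hE
  obtain ⟨hEF, hrE⟩ := mem_part0.1 hE0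
  obtain ⟨hrE', hEF'⟩ := mem_partr.1 hE1
  obtain ⟨hbF, hrb⟩ := mem_part0.1 hb
  have hr : r ∉ E \ b := fun h => hrE (Finset.mem_sdiff.1 h).1
  have h1 : E \ b ∈ F \\ F := Finset.mem_diffs.2 ⟨E, hEF, b, hbF, rfl⟩
  have h2 : insert r (E \ b) ∈ F \\ F := by
    refine Finset.mem_diffs.2 ⟨insert r E, hEF', b, hbF, ?_⟩
    ext s
    simp only [Finset.mem_sdiff, Finset.mem_insert]
    constructor
    · rintro ⟨rfl | hs, hsb⟩
      · exact Or.inl rfl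
      · exact Or.inr ⟨hs, hsb⟩
    · rintro (rfl | ⟨hs, hsb⟩)
      · exact ⟨Or.inl rfl, hrb⟩
      · exact ⟨Or.inr hs, hsb⟩
  exact mem_diffs_partner_of_both hF hr h1 h2

/-- **(C2).** `a \ E ∈ K \\ K` for `a ∈ partr r F`, `E ∈ partner r F`. -/
theorem sdiff_mem_diffs_partner_of_mem_partr {F : Finset (Finset α)} (hF : Tight F) {r : α}
    {a E : Finset α} (ha : a ∈ partr r F) (hE : E ∈ partner r F) :
    a \ E ∈ partner r F \\ partner r F := by
  obtain ⟨hE0, hE1⟩ := Finset.mem_inter.1 hE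
  obtain ⟨hEF, hrE⟩ := mem_part0.1 hE0
  obtain ⟨hrE', hEF'⟩ := mem_partr.1 hE1
  obtain ⟨hra, haF⟩ := mem_partr.1 ha
  have hr : r ∉ a \ E := fun h => hra (Finset.mem_sdiff.1 h).1
  have h1 : a \ E ∈ F \\ F := by
    refine Finset.mem_diffs.2 ⟨insert r a, haF, insert r E, hEF', ?_⟩
    ext s
    simp only [Finset.mem_sdiff, Finset.mem_insert, not_or]
    constructor
    · rintro ⟨rfl | hs, hsr, hsE⟩
      · exact absurd rfl hsr
      · exact ⟨hs, hsE⟩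
    · rintro ⟨hs, hsE⟩
      exact ⟨Or.inr hs, fun h => hra (h ▸ hs), hsE⟩
  have h2 : insert r (a \ E) ∈ F \\ F := by
    refine Finset.mem_diffs.2 ⟨insert r a, haF, E, hEF, ?_⟩
    ext s
    simp only [Finset.mem_sdiff, Finset.mem_insert]
    constructor
    · rintro ⟨rfl | hs, hsE⟩
      · exact Or.inl rfl
      · exact Or.inr ⟨hs, hsE⟩
    · rintro (rfl | ⟨hs, hsE⟩)
      · exact ⟨Or.inl rfl, hrE⟩
      · exact ⟨Or.inr hs, hsE⟩
  exact mem_diffs_partner_of_both hF hr h1 h2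

/-- Every member avoiding `r` contains a member of the (nonempty) partner family. -/
theorem exists_partner_subset_of_mem_part0 {F : Finset (Finset α)} (hF : Tight F) {r : α}
    (hK : (partner r F).Nonempty) {b : Finset α} (hb : b ∈ part0 r F) :
    ∃ E ∈ partner r F, E ⊆ b := by
  have hKt : Tight (partner r F) := (tight_proj_and_partner (r := r) hF).2.1
  refine exists_subset_of_sdiff_mem (b ∪ (partner r F).biUnion id) (partner r F) b ?_ ?_ hK hKt ?_
  · intro E hE
    exact Finset.subset_union_right.trans' (Finset.subset_biUnion_of_mem id hE)
  · exact Finset.subset_union_left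
  · intro E hE
    exact sdiff_mem_diffs_partner_of_mem_part0 hF hE hb

/-- Every member containing `r`, with `r` removed, lies in a member of the (nonempty) partner
family. -/
theorem exists_subset_partner_of_mem_partr {F : Finset (Finset α)} (hF : Tight F) {r : α}
    (hK : (partner r F).Nonempty) {a : Finset α} (ha : a ∈ partr r F) :
    ∃ E ∈ partner r F, a ⊆ E := by
  have hKt : Tight (partner r F) := (tight_proj_and_partner (r := r) hF).2.1
  refine subset_of_diffs_mem (a ∪ (partner r F).biUnion id) (partner r F) a ?_ ?_ hK hKt ?_
  · intro E hE
    exact Finset.subset_union_right.trans' (Finset.subset_biUnion_of_mem id hE)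
  · exact Finset.subset_union_left
  · intro E hE
    exact sdiff_mem_diffs_partner_of_mem_partr hF ha hE

/-- **Lemma B, steps B2–B3 (unconditional):** if `|L| ≤ |F₀|` and `K ≠ ∅`, every `a ∈ L` is
sandwiched `E₁ ⊆ a ⊆ E₀` between two members of `K`. (The remaining step of Lemma B — `a ∈ K`
by the convexity of `K` in its twin-class lattice — is the inductive part of Theorem S.) -/
theorem exists_sandwich_of_mem_partr {F : Finset (Finset α)} (hF : Tight F) {r : α}
    (hK : (partner r F).Nonempty) (h : (partr r F).card ≤ (part0 r F).card) {a : Finset α}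
    (ha : a ∈ partr r F) :
    ∃ E₁ ∈ partner r F, ∃ E₀ ∈ partner r F, E₁ ⊆ a ∧ a ⊆ E₀ := by
  obtain ⟨E₀, hE₀, haE₀⟩ := exists_subset_partner_of_mem_partr hF hK ha
  -- `a` contains a member `t` of `F₀` (dual Lemma 3 on the tight `F₀`, whose differences are `X`)
  obtain ⟨htight, hD0⟩ := tight_part0_of_card_le hF r h
  have hF0ne : (part0 r F).Nonempty := by
    obtain ⟨E, hE⟩ := hK
    exact ⟨E, (Finset.mem_inter.1 hE).1⟩
  obtain ⟨hra, haF⟩ := mem_partr.1 ha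
  have hcond : ∀ s ∈ part0 r F, s \ a ∈ part0 r F \\ part0 r F := by
    intro s hs
    rw [hD0]
    obtain ⟨hsF, hrs⟩ := mem_part0.1 hs
    -- `s \ a = s \ insert r a` is an `r`-free difference of `F`
    have h1 : s \ insert r a ∈ F \\ F := Finset.mem_diffs.2 ⟨s, hsF, insert r a, haF, rfl⟩
    have h2 : s \ insert r a = s \ a := by
      ext x
      simp only [Finset.mem_sdiff, Finset.mem_insert, not_or]
      constructor
      · rintro ⟨hx, _, hxa⟩; exact ⟨hx, hxa⟩
      · rintro ⟨hx, hxa⟩; exact ⟨hx, fun h => hrs (h ▸ hx), hxa⟩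
    rw [h2] at h1
    have hr : r ∉ s \ a := fun hx => hrs (Finset.mem_sdiff.1 hx).1
    rw [← diffs_filter_notMem, Finset.mem_filter]
    exact ⟨h1, hr⟩
  obtain ⟨t, ht, hta⟩ := exists_subset_of_sdiff_mem (a ∪ (part0 r F).biUnion id) (part0 r F) a
    (fun E hE => Finset.subset_union_right.trans' (Finset.subset_biUnion_of_mem id hE))
    Finset.subset_union_left hF0ne htight hcond
  obtain ⟨E₁, hE₁, hE₁t⟩ := exists_partner_subset_of_mem_part0 hF hK ht
  exact ⟨E₁, hE₁, E₀, hE₀, hE₁t.trans hta, haE₀⟩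

end PercRepro.MSTight
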